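import Literature.IUT.HodgeTheaters.GlobalFrobenioids
import Literature.IUT.HodgeTheaters.GlobalFrobenioidsModel
import Literature.IUT.HodgeTheaters.GlobalRealifiedFrobenioidsRigidity
import Literature.IUT.HodgeTheaters.GlobalRealifiedFrobenioidsPrimes
import Literature.IUT.HodgeTheaters.GlobalFrobenioidsRealifyProofs
import Literature.IUT.HodgeArakelov.GlobalGaussianFrobenioidsCor46Proofs
import Literature.IUT.HodgeArakelov.GoodPrimeFrobenioidMonoidsProofs
import HarnessLib

/-!
# [IUTchII] Cor 4.7 (i)–(iii), Cor 4.8 (i)–(iii): the global number-field side of (base-)`ΘNF`-Hodge theaters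
# AT THE NUMBER-FIELD / DIVISOR-MONOID MODEL — proof companion of `GlobalGaussianFrobenioids.lean`

S. Mochizuki, *Inter-universal Teichmüller theory II*, §4, kurims Dec-2020 manuscript, Corollary 4.7 (i) p. 140
l. 41 – p. 141 l. 24, (ii) p. 141 l. 25 – p. 142 l. 17, (iii) p. 142 l. 18–47; Corollary 4.8 (i) p. 150 l. 1–25,
(ii) p. 150 l. 26 – p. 151 l. 12, (iii) p. 151 l. 13–38; proofs p. 142 l. 48–49 / p. 151 l. 39–40 ("follow
immediately from the definitions and the references quoted") [cite: Mochizuki2012, Cor 4.7 p.140]. Claim key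
DISPUTED (D-0012). PROOF-ONLY companion (abc-iut cell, layer L6, seat abc-iut-w4-d035 gen 5; cone rows
IUTchII:Cor4.7(i)(ii)(iii), IUTchII:Cor4.8(i)(ii)(iii), typed as the Prop-slot records `Cor47Statements`,
`Cor48Statements` of abc-iut-L6-t2's `GlobalGaussianFrobenioids.lean`, p404130). NO definition, NO `Prop` fact,
NO instance: theorems about objects already REAL in the tree — abc-iut-L5-t1's [IUTchI] Ex 5.1 (i)/(iv) output
`NFBridgeRecon` (`𝕄^⊛ = F̄^×`, invariants `Mmod`, `Msol`, fixed field `MbarMod`) and `BirationalData.Otilde`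
(`π₁(†𝒟^⊛) ↷ 𝒪̃^⊛× = †𝕄^⊛`); abc-iut-L5-t2's [IUTchI] Ex 3.5 divisor monoids `PhiMod`/`PhiDMod` with `Prime ⥲ V_mod`
(w4-d013), `log⊢_mod(p_v)`, `ρ_v`, `ρ^D_v`, w4-d009's rigidity and w5-d100's two-isomorphism form; the realification map
`EffArithDivisor.realifyMod`; abc-iut-L6-t2's `diagonalSubmonoid`/`diagonalIso` and `PointedHalfLine`.

WHAT IS PROVED (junction level; every item is the printed clause read at the model named):

* **Cor 4.7 (i)** p. 140–141: the chain of invariants "`𝕄^⊛_mod(†𝒟^⊚) ⊆ 𝕄^⊛_sol(†𝒟^⊚) ⊆ 𝕄^⊛(†𝒟^⊚)`,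
  `𝕄̄^⊛_mod(†𝒟^⊚) ⊆ 𝕄̄^⊛(†𝒟^⊚)`, `𝕄^⊛_κ(†𝒟^⊚) ⊆ 𝕄^⊛_∞κ(†𝒟^⊚)`" (`cor47_i_invariants`), the consistency
  "`𝕄̄^⊛_mod = 𝕄^⊛_mod ∪ {0}`" of the two REAL invariants (`nf_mem_mbarMod_iff_eq_zero_or_exists_mmod`,
  `nf_coe_mem_mbarMod_iff`), "`Prime(ℱ^⊛_mod(†𝒟^⊚)) ⥲ V`" VERBATIM with `V̲ ⥲ V_mod` at the realified divisor monoid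
  (`phiMod_primes_bijective_underline`), and the realification functor's compatibility with the
  primes (`realifyMod_single_mem_phiModAt`, `realifyMod_arch_mem_phiModAt`: the prime `[v]` of `Φ(F_mod)` goes
  into the prime component `Φ_{C⊩_mod,v}`);
* **Cor 4.7 (ii) / Cor 4.8 (ii)** p. 141–142 / 150–151, "purely formal" part: for literal labelled copies
  `(−)_j`, `j ∈ LabCusp(†𝒟^⊚) ⥲ F_l^⋇` (`†ζ_⋆` = abc-iut-L5's `IsTorsor.labelEquiv` of `isTorsor_labCuspG`, Prop 4.7
  (iii) PROVED there), the diagonal `(−)_⟨F_l^⋇⟩ ⊆ ∏_j (−)_j` is carried to itself by EVERY relabelling, in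
  particular by `†ζ_⋆` and by the `F_l^⋇`-translations of the labels (`comp_equiv_mem_diagonalSubmonoid_iff`,
  `comp_smul_mem_diagonalSubmonoid_iff`), and the identification `(−)_{j₀} ⥲ (−)_⟨F_l^⋇⟩` is relabelling-invariant
  (`coe_diagonalIso_comp`) — "compatible, relative to `†ζ_⋆`, with the `F_l^⋇`-symmetry";
* **Cor 4.7 (iii) / Cor 4.8 (iii)** p. 142 / 151: the natural isomorphism `D⊩(†𝒟⊢_j) ⥲ ℱ^⊛ℝ_mod(†𝒟^⊚)_j`
  (resp. `†C⊩_j ⥲ (†ℱ^⊛ℝ_mod)_j`) at the divisor monoids is prime-by-prime and `ρ`-compatible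
  (`modToDMod_symm_single`, `rho_eq_rhoDScalar_mul`), respects the two `Prime ⥲ V_mod` bijections
  (`primesEquiv_modToDMod_symm_logMod`), is UNIQUE with these properties (`addEquiv_phiDMod_eq_modToDMod_symm`),
  its labelled product commutes with every relabelling (`piCongrRight_comp_equiv`); the local isomorphisms of
  topological monoids "`ℝ_{≥0}(†𝒟⊢_j)_v ⥲ Ψ_{(ℱ^⊚(†𝒟^⊚)|_j)^ℝ,v}`" are the unique isomorphisms of pointed half-lines
  (`PointedHalfLine.scaleIso_trans/_symm`; `scaleIso_self`, `isoUnique_holds` BY NAME); and the printed COMPATIBILITY of Cor 4.8 (iii)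
  ("compatible with the respective bijections involving `Prime(−)`, the respective local isomorphisms …, the
  isomorphisms of Corollary 4.7, (iii), and the various Kummer-theoretic isomorphisms of (i), (ii)") holds because
  any two prime-by-prime `ρ`-compatible identifications with `Φ_{C⊩_mod}` COINCIDE (`cor48_iii_square`,
  `cor48_iii_triangle`);
* **Cor 4.8 (i)** p. 150: a `π₁(†𝒟^⊛)`-equivariant Kummer isomorphism `†𝕄^⊛ ⥲ 𝕄^⊛(†𝒟^⊚)` ([IUTchI] Ex 5.1 (v), a
  DATUM here) restricts — "by restricting Kummer classes" — to bijections of invariants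
  `†𝕄^⊛_mod ⥲ 𝕄^⊛_mod(†𝒟^⊚)`, `†𝕄^⊛_sol ⥲ 𝕄^⊛_sol(†𝒟^⊚)` (`kummer_map_fixedPoints_eq_mmod`, `kummer_bijOn_mmod`,
  `kummer_image_solInvariants_eq_msol`); the induced isomorphism of realified Frobenioids
  `†ℱ^⊛ℝ_mod ⥲ ℱ^⊛ℝ_mod(†𝒟^⊚)` is, at the divisor monoids, THE identity of `(Φ_{C⊩_mod}, Prime ⥲ V_mod, {ρ_v})`
  (rigidity BY NAME, not restated: abc-iut-w4-d009 `InitialThetaData.phiMod_addEquiv_eq_refl_of_rho_compat`).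

NOT covered (interface/data level in the tree): the "functorial algorithm" sentences ([AbsTopIII] Thm 1.9 = L4-t1; the
categories `ℱ^⊛_mod ⊆ ℱ^⊛ ← ℱ^⊚` = L5-t1 `GlobalFrobenioid.Fmod/fmodIncl/Fcirc`; `ℱ^⊚(†𝒟^⊚)|_j` and the localization functors
of [IUTchI] Ex 5.4 (iv)/(vi) = L5 kit data `S5Local.restrictAt/restrictionOf/RestrictionDatum`; the pseudo-monoids `𝕄^⊛_∞κ`,
`𝕄^⊛_κ` = `NFBridgeRecon` data). Nothing here asserts a disputed claim or takes a side on [IUTchIII] Cor 3.12; typed ≠ proved.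
-/

namespace Literature.IUT.HodgeArakelov

open scoped NNReal
universe u v w u'

/-! ### 1. Cor 4.7 (i): the invariants `𝕄^⊛_mod ⊆ 𝕄^⊛_sol ⊆ 𝕄^⊛`, `𝕄̄^⊛_mod = 𝕄^⊛_mod ∪ {0}` (Ex 5.1 (i) output) -/

section Invariants
open Literature.IUT.HodgeTheaters
variable (N : NFBridgeRecon.{u})

/-- Membership in `𝕄^⊛_mod(†𝒟^⊚)` = the `π₁(†𝒟^⊛)`-invariants ([IUTchI] Ex 5.1 (i) p. 123). [cite: Mochizuki2012, Cor 4.7 (i) p.140] -/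
theorem nf_mem_mmod_iff (x : N.Mast) : x ∈ N.Mmod ↔ ∀ g : N.piDast, g • (x : N.Fbar) = x := Iff.rfl

/-- Membership in `𝕄^⊛_sol(†𝒟^⊚)` = the `π₁^{rat/κ-sol}(†𝒟^⊛)`-invariants ([IUTchI] Ex 5.1 (i) p. 124). [cite: Mochizuki2012, Cor 4.7 (i) p.140] -/
theorem nf_mem_msol_iff (x : N.Mast) :
    x ∈ N.Msol ↔ ∀ g ∈ N.ratKsolKer, N.ratToAst g • (x : N.Fbar) = x := Iff.rfl

/-- Membership in the fixed field `𝕄̄^⊛_mod(†𝒟^⊚)` ("corresponding to `F_mod ⊆ F̄`"). [cite: Mochizuki2012, Cor 4.7 (i) p.141] -/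
theorem nf_mem_mbarMod_iff (a : N.Fbar) : a ∈ N.MbarMod ↔ ∀ g : N.piDast, g • a = a := Iff.rfl

/-- **[IUTchII] Cor 4.7 (i)** (p. 140 l. 58 – p. 141 l. 2), the displayed chain of invariants at the Ex 5.1 (i)
output: `𝕄^⊛_mod ⊆ 𝕄^⊛_sol ⊆ 𝕄^⊛`, `𝕄̄^⊛_mod ⊆ 𝕄̄^⊛` (a subfield), `𝕄^⊛_κ ⊆ 𝕄^⊛_∞κ (⊆ 𝕄^⊛_∞κ×)`.
[cite: Mochizuki2012, Cor 4.7 (i) p.140] -/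
theorem cor47_i_invariants :
    N.Mmod ≤ N.Msol ∧ N.Msol ≤ ⊤ ∧ (N.MbarMod : Set N.Fbar) ⊆ Set.univ ∧ N.Mκ ⊆ N.Minfκ ∧ N.Minfκ ⊆ N.Minfκx :=
  ⟨N.mmod_le_msol, le_top, Set.subset_univ _, N.mκ_subset, N.minfκ_subset⟩

/-- `𝕄̄^⊛_mod = 𝕄^⊛_mod ∪ {0}`, units half: `x ∈ 𝕄^⊛ = F̄^×` lies in the fixed FIELD `𝕄̄^⊛_mod` iff it lies in the invariant
SUBGROUP `𝕄^⊛_mod` — abc-iut-L5-t1's two REAL typings agree ([IUTchI] Ex 5.1 (i) p. 123). [cite: Mochizuki2012, Cor 4.7 (i) p.141] -/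
theorem nf_coe_mem_mbarMod_iff (x : N.Mast) : (x : N.Fbar) ∈ N.MbarMod ↔ x ∈ N.Mmod := Iff.rfl

/-- `𝕄̄^⊛_mod = 𝕄^⊛_mod ∪ {0}`: an element of `F̄` is `π₁(†𝒟^⊛)`-invariant iff it is `0` or (the value of) an element of
`𝕄^⊛_mod` ([IUTchI] Ex 5.1 (i) p. 123; [IUTchII] Cor 4.7 (i) p. 140–141). [cite: Mochizuki2012, Cor 4.7 (i) p.141] -/
theorem nf_mem_mbarMod_iff_eq_zero_or_exists_mmod (a : N.Fbar) :
    a ∈ N.MbarMod ↔ a = 0 ∨ ∃ x ∈ N.Mmod, (x : N.Fbar) = a := by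
  constructor
  · intro ha
    by_cases h0 : a = 0
    · exact Or.inl h0
    · exact Or.inr ⟨Units.mk0 a h0, (nf_coe_mem_mbarMod_iff N (Units.mk0 a h0)).mp ha, rfl⟩
  · rintro (rfl | ⟨x, hx, rfl⟩)
    · exact fun g => smul_zero g
    · exact (nf_coe_mem_mbarMod_iff N x).mpr hx

end Invariants

/-! ### 2. Cor 4.8 (i): Kummer isomorphisms restrict to the invariants ("by restricting Kummer classes") -/

section Kummer
open Literature.IUT.HodgeTheaters
variable (N : NFBridgeRecon.{u}) (β : BirationalData N.piDast)

/-- **[IUTchII] Cor 4.8 (i)** (p. 150 l. 8–16, "by restricting Kummer classes as in [IUTchI], Example 5.1, (v),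
natural Kummer-theoretic isomorphisms … `†𝕄^⊛_mod ⥲ 𝕄^⊛_mod(†𝒟^⊚)`"), at the Ex 5.1 (i)/(iv) output: a
`π₁(†𝒟^⊛)`-EQUIVARIANT multiplicative isomorphism `κ : †𝕄^⊛ = 𝒪̃^⊛× ⥲ 𝕄^⊛(†𝒟^⊚) = F̄^×` (the Kummer isomorphism of
[IUTchI] Ex 5.1 (v), a datum here) maps the subgroup of `π₁(†𝒟^⊛)`-invariants `†𝕄^⊛_mod` EXACTLY onto
`𝕄^⊛_mod(†𝒟^⊚)`. [cite: Mochizuki2012, Cor 4.8 (i) p.150] -/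
theorem kummer_map_fixedPoints_eq_mmod (κ : β.Otilde ≃* N.Mast)
    (hκ : ∀ (g : N.piDast) (x : β.Otilde), ((κ (g • x) : N.Mast) : N.Fbar) = g • ((κ x : N.Mast) : N.Fbar)) :
    (FixedPoints.subgroup N.piDast β.Otilde).map κ.toMonoidHom = N.Mmod := by
  ext y
  rw [Subgroup.mem_map, nf_mem_mmod_iff]
  constructor
  · rintro ⟨x, hx, rfl⟩ g
    rw [FixedPoints.mem_subgroup] at hx
    rw [MulEquiv.coe_toMonoidHom, ← hκ, hx g]
  · intro hy
    refine ⟨κ.symm y, ?_, by rw [MulEquiv.coe_toMonoidHom, MulEquiv.apply_symm_apply]⟩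
    rw [FixedPoints.mem_subgroup]
    intro g
    apply κ.injective
    apply Units.ext
    rw [hκ, MulEquiv.apply_symm_apply]
    exact hy g

/-- **[IUTchII] Cor 4.8 (i)** (p. 150), bijection form: the equivariant Kummer isomorphism restricts to a
BIJECTION `†𝕄^⊛_mod ⥲ 𝕄^⊛_mod(†𝒟^⊚)` ("natural Kummer-theoretic isomorphisms").
[cite: Mochizuki2012, Cor 4.8 (i) p.150] -/
theorem kummer_bijOn_mmod (κ : β.Otilde ≃* N.Mast)
    (hκ : ∀ (g : N.piDast) (x : β.Otilde), ((κ (g • x) : N.Mast) : N.Fbar) = g • ((κ x : N.Mast) : N.Fbar)) :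
    Set.BijOn κ (MulAction.fixedPoints N.piDast β.Otilde) (N.Mmod : Set N.Mast) := by
  have h := kummer_map_fixedPoints_eq_mmod N β κ hκ
  refine ⟨fun x hx => ?_, κ.injective.injOn, fun y hy => ?_⟩
  · rw [← h, SetLike.mem_coe, Subgroup.mem_map]
    exact ⟨x, hx, rfl⟩
  · have hy' : y ∈ (FixedPoints.subgroup N.piDast β.Otilde).map κ.toMonoidHom := by rw [h]; exact hy
    obtain ⟨x, hx, rfl⟩ := hy'
    exact ⟨x, hx, rfl⟩

/-- **[IUTchII] Cor 4.8 (i)** (p. 150 l. 12, "`{π₁^{κ-sol}(†𝒟^⊛) ↷ †𝕄^⊛_sol} ⥲ {π₁^{κ-sol}(†𝒟^⊛) ↷ 𝕄^⊛_sol(†𝒟^⊚)}`"), at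
the Ex 5.1 (i)/(iv) output: the equivariant Kummer isomorphism carries the `π₁^{rat/κ-sol}(†𝒟^⊛)`-invariants of
`†𝕄^⊛` (acting through `π₁^rat ↠ π₁(†𝒟^⊛)`) EXACTLY onto `𝕄^⊛_sol(†𝒟^⊚)`. [cite: Mochizuki2012, Cor 4.8 (i) p.150] -/
theorem kummer_image_solInvariants_eq_msol (κ : β.Otilde ≃* N.Mast)
    (hκ : ∀ (g : N.piDast) (x : β.Otilde), ((κ (g • x) : N.Mast) : N.Fbar) = g • ((κ x : N.Mast) : N.Fbar)) :
    κ '' {x : β.Otilde | ∀ g ∈ N.ratKsolKer, N.ratToAst g • x = x} = (N.Msol : Set N.Mast) := by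
  ext y
  rw [Set.mem_image, SetLike.mem_coe, nf_mem_msol_iff]
  constructor
  · rintro ⟨x, hx, rfl⟩ g hg
    rw [← hκ, hx g hg]
  · intro hy
    refine ⟨κ.symm y, fun g hg => ?_, κ.apply_symm_apply y⟩
    apply κ.injective
    apply Units.ext
    rw [hκ, MulEquiv.apply_symm_apply]
    exact hy g hg

/-- **[IUTchII] Cor 4.8 (i)** (p. 150), the `mod ⊆ sol` compatibility of the restricted Kummer isomorphisms: the
image of the `π₁(†𝒟^⊛)`-invariants lies in the image of the `π₁^{rat/κ-sol}`-invariants, matching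
`𝕄^⊛_mod(†𝒟^⊚) ⊆ 𝕄^⊛_sol(†𝒟^⊚)` (Cor 4.7 (i)). [cite: Mochizuki2012, Cor 4.8 (i) p.150] -/
theorem kummer_image_fixedPoints_subset_msol (κ : β.Otilde ≃* N.Mast)
    (hκ : ∀ (g : N.piDast) (x : β.Otilde), ((κ (g • x) : N.Mast) : N.Fbar) = g • ((κ x : N.Mast) : N.Fbar)) :
    κ '' MulAction.fixedPoints N.piDast β.Otilde ⊆ (N.Msol : Set N.Mast) := by
  intro y hy
  have hy' : y ∈ (N.Mmod : Set N.Mast) := (kummer_bijOn_mmod N β κ hκ).mapsTo.image_subset hy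
  exact N.mmod_le_msol hy'

end Kummer

/-! ### 3. Cor 4.7 (i): `Prime(ℱ^⊛_mod(†𝒟^⊚)) ⥲ V` and the realification functor, at the divisor monoids -/

section Primes
open Literature.IUT.HodgeTheaters Literature.AlgebraicGeometry.Frobenioids Literature.IUT.LogThetaLattice
variable {F : Type u} {K : Type v} {Fbar : Type w} [Field F] [NumberField F] [Field K]
  [NumberField K] [Algebra F K] [Field Fbar] [Algebra F Fbar] [Algebra K Fbar]
  {E : WeierstrassCurve F} [E.IsElliptic] {l : ℕ} {P : BadPlacePredicates K}
  (D : InitialThetaData F K Fbar E l P)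

/-- **[IUTchII] Cor 4.7 (i)** (p. 141 l. 12–16, "we regard the Frobenioid `ℱ^⊛_mod(†𝒟^⊚)` as being equipped with a
natural bijection `Prime(ℱ^⊛_mod(†𝒟^⊚)) ⥲ V` [cf. the final portion of [IUTchI], Example 5.1, (v)]") VERBATIM with
`V = V̲ ⊆ V(K)` (not `V_mod`), at the realified divisor monoid `Φ_{C⊩_mod}` of the REAL initial Θ-data: through
`V̲ ⥲ V_mod` ([IUTchI] Def 3.1 (e), `InitialThetaData.V_bijOn`) the map `v̲ ↦ [log⊢_mod(p_v)]` is a bijection from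
`V̲` onto `Prime(Φ_{C⊩_mod})` (abc-iut-w4-d013's `primes_phiMod_bijective` composed with the place bijection; the
`D`-copy twin is `primes_phiDMod_bijective_underline`). [cite: Mochizuki2012, Cor 4.7 (i) p.141] -/
theorem phiMod_primes_bijective_underline :
    Function.Bijective fun w : D.V =>
      (Quotient.mk (primarySetoid _)
        ⟨Multiplicative.ofAdd (D.logMod (toVMod F K E (w : Val K))), D.isPrimary_logMod (toVMod F K E (w : Val K))⟩ :
          Primes (Multiplicative D.PhiMod)) :=
  D.primes_phiMod_bijective.comp
    ((Equiv.Set.univ (Val (fieldOfModuli E))).bijective.comp (D.V_bijOn.equiv _).bijective)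

end Primes

section Realify
open Literature.IUT.HodgeTheaters Literature.AlgebraicGeometry.Frobenioids

-- the tree's realification map is typed at universe `0` (`GlobalFrobenioidsRealify.lean`)
variable {F : Type} {K : Type} {Fbar : Type} [Field F] [NumberField F] [Field K] [NumberField K] [Algebra F K] [Field Fbar] [Algebra F Fbar] [Algebra K Fbar]
  {E : WeierstrassCurve F} [E.IsElliptic] {l : ℕ} {P : BadPlacePredicates K}
  (D : InitialThetaData F K Fbar E l P)

/-- **[IUTchII] Cor 4.7 (i)** (p. 141 l. 17–19, "the natural realification functor `ℱ^⊛_mod(†𝒟^⊚) → ℱ^⊛ℝ_mod(†𝒟^⊚)`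
[cf. [IUTchI], Example 5.1, (vii); [FrdI], Proposition 5.3]"), compatibility with the primes at the divisor
monoids: the realification map `Φ(F_mod) → Φ_{C⊩_mod}` (`EffArithDivisor.realifyMod`) carries the prime divisor `[v]`
of a finite place into the prime component `Φ_{C⊩_mod,v}` (`PhiModAt`). [cite: Mochizuki2012, Cor 4.7 (i) p.141] -/
theorem realifyMod_single_mem_phiModAt (v : NumberField.FinitePlace (fieldOfModuli E)) (n : ℕ) :
    EffArithDivisor.realifyMod (fieldOfModuli E) (Finsupp.single v n, 0) ∈ D.PhiModAt (Sum.inr v) := by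
  intro v' hv'
  rcases v' with w | w
  · rw [realifyMod_apply_inl]
    rfl
  · rw [realifyMod_apply_inr]
    have hw : w ≠ v := fun h => hv' (by rw [h])
    rw [Finsupp.single_eq_of_ne hw, Nat.cast_zero, zero_mul]

open scoped Classical in
/-- **[IUTchII] Cor 4.7 (i)** (p. 141 l. 17–19), archimedean primes: the realification map carries the archimedean
divisor supported at `v ∈ V^arc` into the prime component `Φ_{C⊩_mod,v}`. [cite: Mochizuki2012, Cor 4.7 (i) p.141] -/
theorem realifyMod_arch_mem_phiModAt (v : NumberField.InfinitePlace (fieldOfModuli E)) (x : ℝ≥0) :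
    EffArithDivisor.realifyMod (fieldOfModuli E) (0, Pi.single v x) ∈ D.PhiModAt (Sum.inl v) := by
  rw [realifyMod_arch_single]
  intro v' hv'
  exact Finsupp.single_eq_of_ne hv'

end Realify

/-! ### 4. Cor 4.7 (iii) / 4.8 (iii): `D⊩(†𝒟⊢_j) ⥲ ℱ^⊛ℝ_mod(†𝒟^⊚)_j`, `†C⊩_j ⥲ (†ℱ^⊛ℝ_mod)_j` at the divisor monoids -/

section Realified
open Literature.IUT.HodgeTheaters Literature.AlgebraicGeometry.Frobenioids Literature.IUT.LogThetaLattice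
variable {F : Type u} {K : Type v} {Fbar : Type w} [Field F] [NumberField F] [Field K]
  [NumberField K] [Algebra F K] [Field Fbar] [Algebra F Fbar] [Algebra K Fbar]
  {E : WeierstrassCurve F} [E.IsElliptic] {l : ℕ} {P : BadPlacePredicates K}
  (D : InitialThetaData F K Fbar E l P)

/-- **[IUTchII] Cor 4.7 (iii)** (p. 142 l. 33–35, "a natural isomorphism of Frobenioids `D⊩(†𝒟⊢_j) ⥲ ℱ^⊛ℝ_mod(†𝒟^⊚)_j`"),
at the divisor monoids of the REAL initial Θ-data ([IUTchI] Ex 3.5 (iii) `Φ_{D⊩_mod}` ↔ Ex 3.5 (i) `Φ_{C⊩_mod}` = the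
realification of `†ℱ^⊛_mod`): the natural isomorphism `Φ_{D⊩_mod} ⥲ Φ_{C⊩_mod}` (inverse of abc-iut-L5-t2's
tautological `modToDMod`) acts PRIME BY PRIME — "compatible with the respective bijections involving `Prime(−)`".
[cite: Mochizuki2012, Cor 4.7 (iii) p.142] -/
theorem modToDMod_symm_single (v : Val (fieldOfModuli E)) (x : ℝ≥0) :
    D.modToDMod.symm (Finsupp.single v x) = Finsupp.single v x := rfl

/-- **[IUTchII] Cor 4.7 (iii)** (p. 142 l. 42–44, "compatible … with the respective local isomorphisms of topological
monoids"): the comparison isomorphisms agree through `Φ_{D⊩_mod} ⥲ Φ_{C⊩_mod}` — `ρ_v` has the scalar of `ρ^D_v`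
([IUTchI] Ex 3.5 (iii): "`log^D_mod(p_v) ↦ [K_v̲:(F_mod)_v]⁻¹ log^D_Φ(p_v)`"). [cite: Mochizuki2012, Cor 4.7 (iii) p.142] -/
theorem rho_eq_rhoDScalar_mul (w : Val K) (x : ℝ≥0) : D.rho w x = D.rhoDScalar w * x := rfl

/-- **[IUTchII] Cor 4.7 (iii)** (p. 142 l. 42–43), `Prime(−)`-compatibility through BOTH printed bijections: the class
of the image of `log^D_mod(p_v)` under `Φ_{D⊩_mod} ⥲ Φ_{C⊩_mod}` is the prime labelled `v` of `Φ_{C⊩_mod}` (w4-d013's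
`primesEquiv`, [IUTchI] Ex 3.5 (i) "`Prime(C⊩_mod) ⥲ V_mod`"). [cite: Mochizuki2012, Cor 4.7 (iii) p.142] -/
theorem primesEquiv_modToDMod_symm_logMod (v : Val (fieldOfModuli E)) :
    FinsuppNNReal.primesEquiv (Quotient.mk (primarySetoid _)
      ⟨Multiplicative.ofAdd (D.modToDMod.symm (D.modToDMod (D.logMod v))), D.isPrimary_logMod v⟩ :
        Primes (Multiplicative D.PhiMod)) = v :=
  D.primesEquiv_mk_logMod v

/-- **[IUTchII] Cor 4.7 (iii)** (p. 142 l. 33–44), UNIQUENESS ("natural"): an additive isomorphism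
`Φ_{D⊩_mod} ⥲ Φ_{C⊩_mod}` that acts prime by prime (through maps `e_v`) compatibly with the comparison isomorphisms
(`ρ_w ∘ e_v = ρ^D_w` for some `w ∈ V(K)` over each `v`) IS the natural one — by abc-iut-w4-d009's rigidity of
`(Φ_{C⊩_mod}, Prime ⥲ V_mod, {ρ_v})`. [cite: Mochizuki2012, Cor 4.7 (iii) p.142] -/
theorem addEquiv_phiDMod_eq_modToDMod_symm (e : D.PhiDMod ≃+ D.PhiMod)
    (ev : Val (fieldOfModuli E) → (ℝ≥0 →+ ℝ≥0))
    (he : ∀ v x, e (Finsupp.single v x) = Finsupp.single v (ev v x))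
    (hρ : ∀ v, ∃ w : Val K, ∀ x, D.rho w (ev v x) = D.rhoDScalar w * x) : e = D.modToDMod.symm :=
  D.phiMod_addEquiv_eq_refl_of_rho_compat e ev he hρ

/-- **[IUTchII] Cor 4.7 (iii) / 4.8 (iii)**, labelled form ("for each `j ∈ LabCusp(†𝒟^⊚)` … all of these structures are
compatible with the respective `F_l^⋇`-symmetrizing isomorphisms", p. 142 l. 45–47 / p. 151 l. 36–38): a labelled
family of isomorphisms that is THE SAME isomorphism at every label commutes with every relabelling of
`J = LabCusp(†𝒟^⊚)` (in particular with `†ζ_⋆` and with the `F_l^⋇`-translations). [cite: Mochizuki2012, Cor 4.7 (iii) p.142] -/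
theorem piCongrRight_comp_equiv {J : Type u'} {A : Type u} {B : Type v} [AddCommMonoid A] [AddCommMonoid B]
    (e : A ≃+ B) (σ : J → J) (x : J → A) :
    (AddEquiv.piCongrRight fun _ : J => e) (fun j => x (σ j)) = fun j => (AddEquiv.piCongrRight fun _ : J => e) x (σ j) :=
  rfl

/-- **[IUTchII] Cor 4.8 (iii)** (p. 151 l. 30–36, "a natural isomorphism of Frobenioids `†C⊩_j ⥲ (†ℱ^⊛ℝ_mod)_j` … which is
compatible … with the respective bijections involving `Prime(−)`, the respective local isomorphisms of topological
monoids …, the isomorphisms of Corollary 4.7, (iii), and the various [Kummer-theoretic] isomorphisms of (i), (ii)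
[cf. also Corollary 4.6, (ii)]"), SQUARE form at the divisor monoids: let `a : A ⥲ Φ_{C⊩_mod}` (`†C⊩_j ⥲ D⊩(†𝒟⊢_j) ⥲ …`,
Cor 4.6 (ii) / 4.7 (iii)) and `b : B ⥲ Φ_{C⊩_mod}` (`(†ℱ^⊛ℝ_mod)_j ⥲ ℱ^⊛ℝ_mod(†𝒟^⊚)_j`, Cor 4.8 (i)) be identifications and
`f : A ⥲ B` the natural isomorphism; if `b ∘ f ∘ a⁻¹` is prime-by-prime and `ρ`-compatible then the square COMMUTES:
`b ∘ f = a` (abc-iut-w5-d100 `addEquiv_eq_of_rho_compat`). [cite: Mochizuki2012, Cor 4.8 (iii) p.151] -/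
theorem cor48_iii_square {A : Type u'} [AddCommMonoid A] {B : Type u'} [AddCommMonoid B]
    (a : A ≃+ D.PhiMod) (b : B ≃+ D.PhiMod) (f : A ≃+ B)
    (ev : Val (fieldOfModuli E) → (ℝ≥0 →+ ℝ≥0))
    (he : ∀ v x, b (f (a.symm (Finsupp.single v x))) = Finsupp.single v (ev v x))
    (hρ : ∀ v, ∃ w : Val K, ∀ x, D.rho w (ev v x) = D.rho w x) : f.trans b = a :=
  (addEquiv_eq_of_rho_compat D a (f.trans b) ev (fun v x => by rw [AddEquiv.trans_apply, he]) hρ).symm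

/-- **[IUTchII] Cor 4.8 (iii)** (p. 151), TRIANGLE form: two identifications `a, a' : A ⥲ Φ_{C⊩_mod}` of the same
realified Frobenioid's divisor monoid (e.g. `†C⊩_j → D⊩(†𝒟⊢_j) → ℱ^⊛ℝ_mod(†𝒟^⊚)_j` via Cor 4.7 (iii) and
`†C⊩_j → (†ℱ^⊛ℝ_mod)_j → ℱ^⊛ℝ_mod(†𝒟^⊚)_j` via Cor 4.8 (i)) whose difference is prime-by-prime and `ρ`-compatible
COINCIDE — "mutually compatible". [cite: Mochizuki2012, Cor 4.8 (iii) p.151] -/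
theorem cor48_iii_triangle {A : Type u'} [AddCommMonoid A] (a a' : A ≃+ D.PhiMod)
    (ev : Val (fieldOfModuli E) → (ℝ≥0 →+ ℝ≥0))
    (he : ∀ v x, a' (a.symm (Finsupp.single v x)) = Finsupp.single v (ev v x))
    (hρ : ∀ v, ∃ w : Val K, ∀ x, D.rho w (ev v x) = D.rho w x) : a = a' :=
  addEquiv_eq_of_rho_compat D a a' ev he hρ

end Realified

/-! ### 5. Cor 4.7 (iii): the local isomorphisms `ℝ_{≥0}(†𝒟⊢_j)_v ⥲ Ψ_{(ℱ^⊚(†𝒟^⊚)|_j)^ℝ,v}` of pointed half-lines -/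

section Local

/-- **[IUTchII] Cor 4.7 (iii) / 4.8 (iii)** (p. 142 l. 36–44 / p. 151 l. 32–34, "for each `v ∈ V`, a natural isomorphism of
topological monoids `ℝ_{≥0}(†𝒟⊢_j)_v ⥲ Ψ_{(ℱ^⊚(†𝒟^⊚)|_j)^ℝ,v}`" … "compatible … with the respective local isomorphisms of
topological monoids … [and] the isomorphisms of Corollary 4.7, (iii)"): the local monoids are copies of `ℝ_{≥0}` pinned by
their distinguished elements (`log^D_Φ(p_v)`, `log_Φ(p_v)`, …); the natural isomorphism between two of them is
abc-iut-L6-t2's `scaleIso` (UNIQUE: `isoUnique_holds`; `scaleIso A A = id`: `PointedHalfLine.scaleIso_self` in the tree), and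
these isomorphisms are MUTUALLY COMPATIBLE — they compose along any chain `ℝ_{≥0}(†𝒟⊢_j)_v ⥲ Ψ_{(ℱ^⊚|_j)^ℝ,v} ⥲ Φ_{†C⊩_j,v} ⥲ …`.
[cite: Mochizuki2012, Cor 4.7 (iii) p.142] -/
theorem PointedHalfLine.scaleIso_trans (A B C : PointedHalfLine) :
    (scaleIso A B).trans (scaleIso B C) = scaleIso A C := by
  refine AddEquiv.ext fun x => ?_
  have ha := A.pt_pos.ne'
  have hb := B.pt_pos.ne'
  show C.pt / B.pt * (B.pt / A.pt * x) = C.pt / A.pt * x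
  field_simp

/-- **[IUTchII] Cor 4.7 (iii) / 4.8 (iii)** (p. 142 / p. 151), symmetry of the local isomorphisms of pointed half-lines:
the inverse of the natural isomorphism `A ⥲ B` is the natural isomorphism `B ⥲ A`. [cite: Mochizuki2012, Cor 4.7 (iii) p.142] -/
theorem PointedHalfLine.scaleIso_symm (A B : PointedHalfLine) : (scaleIso A B).symm = scaleIso B A :=
  AddEquiv.ext fun _ => rfl

end Local

/-! ### 6. Cor 4.7 (ii) / 4.8 (ii): labels `j ∈ LabCusp(†𝒟^⊚) ⥲ F_l^⋇`, symmetrizing isomorphisms, diagonals -/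

section Labels

variable {S : Type u} {T : Type v} {M : Type w} [CommMonoid M]

/-- **[IUTchII] Cor 4.7 (ii) / 4.8 (ii)** (p. 141 l. 47 – p. 142 l. 17 / p. 150 l. 26 – p. 151 l. 12, "these symmetrizing
isomorphisms are compatible, relative to `†ζ_⋆`, with the `F_l^⋇`-symmetry … and determine diagonal …
`(−)_⟨F_l^⋇⟩ ⊆ ∏_{j ∈ F_l^⋇} (−)_j` … in a purely formal sense"), for literal labelled copies of a monoid `M` (the
objects with subscript `mod`, on which "the various conjugacy indeterminacies involved act in a synchronized
fashion", Rmk 4.7.2): relabelling along ANY bijection `σ : S ⥲ T` of label sets — e.g. `†ζ_⋆ : LabCusp(†𝒟^⊚) ⥲ F_l^⋇`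
(abc-iut-L5 `IsTorsor.labelEquiv` of `BaseThetaDatum.isTorsor_labCuspG`, [IUTchI] Prop 4.7 (iii)) — identifies the
diagonal over `T` with the diagonal over `S`. [cite: Mochizuki2012, Cor 4.7 (ii) p.142] -/
theorem comp_equiv_mem_diagonalSubmonoid_iff (σ : S ≃ T) (x : T → M) :
    (fun s => x (σ s)) ∈ diagonalSubmonoid S M ↔ x ∈ diagonalSubmonoid T M := by
  rw [mem_diagonalSubmonoid, mem_diagonalSubmonoid]
  constructor
  · intro h t t'
    have := h (σ.symm t) (σ.symm t')
    rwa [Equiv.apply_symm_apply, Equiv.apply_symm_apply] at this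
  · intro h s s'
    exact h (σ s) (σ s')

/-- **[IUTchII] Cor 4.7 (ii) / 4.8 (ii)** (p. 141 l. 34–38, "the natural poly-action of `F_l^⋇` on `†𝒟^⊚` [cf. [IUTchI],
Example 4.3, (iv)] induces isomorphisms between the labeled data … [`F_l^⋇`-]symmetrizing isomorphisms"): the
`F_l^⋇`-translation `c ↦ g • c` of the torsor of labels `LabCusp(†𝒟^⊚)` (every translation IS induced by an
automorphism of `†𝒟^⊚`: abc-iut-L5 `BaseThetaDatum.exists_aut_smul`) carries the diagonal of literal copies to
itself — the symmetrizing isomorphisms of `mod`-objects are compatible with the `F_l^⋇`-symmetry.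
[cite: Mochizuki2012, Cor 4.7 (ii) p.141] -/
theorem comp_smul_mem_diagonalSubmonoid_iff {G : Type u'} [Group G] [MulAction G T] (g : G) (x : T → M) :
    (fun t => x (g • t)) ∈ diagonalSubmonoid T M ↔ x ∈ diagonalSubmonoid T M :=
  comp_equiv_mem_diagonalSubmonoid_iff (MulAction.toPerm g) x

/-- **[IUTchII] Cor 4.7 (ii)** (p. 142 l. 12–17, the diagonal "as a purely formal notational shorthand for the
`F_l^⋇`-symmetrizing isomorphisms"): the identification of one copy with the diagonal (abc-iut-L6-t2 `diagonalIso`,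
"`(−)_{j₀} ⥲ (−)_⟨F_l^⋇⟩`") is invariant under every relabelling `σ` of the labels — its underlying family is
constant. [cite: Mochizuki2012, Cor 4.7 (ii) p.142] -/
theorem coe_diagonalIso_comp [Nonempty T] (σ : T → T) (m : M) :
    (fun t => ((diagonalIso T M m : diagonalSubmonoid T M) : T → M) (σ t)) =
      ((diagonalIso T M m : diagonalSubmonoid T M) : T → M) := by
  funext t
  rw [coe_diagonalIso, coe_diagonalIso]

end Labels

end Literature.IUT.HodgeArakelov
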